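import Mathlib
import Literature.NumberTheory.LFunctions.RiemannXiLogDeriv
import Literature.Analysis.SpecialFunctions.DigammaGauss
import Summits.RiemannHypothesis.RiemannHypothesis.Theorems.LeeYangLeeyangGhsFaceXiPair

/-!
# RiemannHypothesis / LeeYang — `LeeyangGhsFaceXi`, part 3: concavity of `Re ξ'/ξ` on `[10, ∞)`

Helper file for item stmt-RiemannHypothesis-0454. On `Re s > 1` the tree proves
`ξ'/ξ(s) = 1/s + 1/(s−1) − (log π)/2 + ½ψ(s/2) − Σ Λ(n) n^{-s}`
(`Literature.NumberTheory.LFunctions.logDeriv_riemannXi_eq_of_one_lt_re`) and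
`ψ(w) + γ = Σ_k (1/(k+1) − 1/(w+k))`
(`Literature.Analysis.SpecialFunctions.Complex.hasSum_one_div_sub_one_div_digamma`). On the real
axis this writes `D(σ) = Re ξ'/ξ(σ)` for `σ ≥ 10` as
`[1/(σ−1) − Σ_{k=1}^{5} 1/(σ+2k)] + const + ½ Σ_{k≥6} (1/(k+1) − 2/(σ+2k)) − Σ_n Λ(n) n^{−σ}`:
the bracket has second derivative `2/(σ−1)³ − Σ_{k=1}^{5} 2/(σ+2k)³ ≤ 0` for `σ ≥ 10`, and the
two series are pointwise sums of concave functions. Hence `D` is concave on `[10, ∞)`.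
-/

noncomputable section

open Complex Set Literature.NumberTheory.LFunctions
open scoped LSeries.notation ArithmeticFunction.vonMangoldt

-- D-0017: single-problem summit ⇒ namespace `Summit.RiemannHypothesis.RiemannHypothesis.…` by design
-- (the Summits library sets `weak.linter.dupNamespace = false`; repeated here for stand-alone checks).
set_option linter.dupNamespace false

namespace Summit.RiemannHypothesis.RiemannHypothesis.Theorems

/-- Concavity from two derivatives on the set, with `f'' ≤ 0` there. [folklore] -/
theorem LeeYangGhs.concaveOn_of_hasDerivAt2_nonpos' {D : Set ℝ} (hD : Convex ℝ D)
    {f f' f'' : ℝ → ℝ} (hf' : ∀ x ∈ D, HasDerivAt f (f' x) x)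
    (hf'' : ∀ x ∈ D, HasDerivAt f' (f'' x) x) (h : ∀ x ∈ D, f'' x ≤ 0) : ConcaveOn ℝ D f :=
  concaveOn_of_hasDerivWithinAt2_nonpos hD
    (fun x hx => (hf' x hx).continuousAt.continuousWithinAt)
    (fun x hx => (hf' x (interior_subset hx)).hasDerivWithinAt)
    (fun x hx => (hf'' x (interior_subset hx)).hasDerivWithinAt)
    (fun x hx => h x (interior_subset hx))

/-- `d/dσ (σ+m)⁻¹ = −((σ+m)²)⁻¹`. [folklore] -/
theorem LeeYangGhs.hasDerivAt_inv_add (m : ℝ) {σ : ℝ} (h : σ + m ≠ 0) :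
    HasDerivAt (fun σ : ℝ => (σ + m)⁻¹) (-((σ + m) ^ 2)⁻¹) σ := by
  have h0 : HasDerivAt (fun σ : ℝ => σ + m) 1 σ := (hasDerivAt_id' σ).add_const m
  refine (h0.fun_inv h).congr_deriv ?_
  field_simp

/-- `d/dσ [−((σ+m)²)⁻¹] = 2((σ+m)³)⁻¹`. [folklore] -/
theorem LeeYangGhs.hasDerivAt_neg_inv_sq_add (m : ℝ) {σ : ℝ} (h : σ + m ≠ 0) :
    HasDerivAt (fun σ : ℝ => -((σ + m) ^ 2)⁻¹) (2 * ((σ + m) ^ 3)⁻¹) σ := by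
  have h0 : HasDerivAt (fun σ : ℝ => σ + m) 1 σ := (hasDerivAt_id' σ).add_const m
  have h2 : HasDerivAt (fun σ : ℝ => (σ + m) ^ 2) (2 * (σ + m)) σ := by
    simpa using h0.fun_pow 2
  have hne : (σ + m) ^ 2 ≠ 0 := pow_ne_zero 2 h
  refine ((h2.fun_inv hne).neg).congr_deriv ?_
  field_simp

/-- The comparison `1/(t+a)³ ≥ (9/(9+a))³/t³` for `t ≥ 9`, `a ≥ 0`, in product form. [folklore] -/
theorem LeeYangGhs.cube_compare {t a : ℝ} (ht : 9 ≤ t) (ha : 0 ≤ a) :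
    729 / ((9 + a) ^ 3) * (t ^ 3)⁻¹ ≤ ((t + a) ^ 3)⁻¹ := by
  have ht0 : 0 < t := by linarith
  have h1 : 9 * (t + a) ≤ (9 + a) * t := by nlinarith
  have h2 : (9 * (t + a)) ^ 3 ≤ ((9 + a) * t) ^ 3 :=
    pow_le_pow_left₀ (by positivity) h1 3
  have key : 729 * (t + a) ^ 3 ≤ (9 + a) ^ 3 * t ^ 3 :=
    calc 729 * (t + a) ^ 3 = (9 * (t + a)) ^ 3 := by ring
      _ ≤ ((9 + a) * t) ^ 3 := h2
      _ = (9 + a) ^ 3 * t ^ 3 := by ring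
  have hL : 729 / (9 + a) ^ 3 * (t ^ 3)⁻¹ = 729 / ((9 + a) ^ 3 * t ^ 3) := by
    field_simp
  rw [hL, inv_eq_one_div, div_le_div_iff₀ (by positivity) (by positivity)]
  linarith

/-- **The finite bracket is concave on `[10, ∞)`**:
`σ ↦ (σ−1)⁻¹ − [(σ+2)⁻¹ + (σ+4)⁻¹ + (σ+6)⁻¹ + (σ+8)⁻¹ + (σ+10)⁻¹]`. [folklore] -/
theorem LeeYangGhs.concaveOn_bracket :
    ConcaveOn ℝ (Ici (10 : ℝ)) (fun σ : ℝ => (σ + (-1))⁻¹ -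
      ((σ + 2)⁻¹ + (σ + 4)⁻¹ + (σ + 6)⁻¹ + (σ + 8)⁻¹ + (σ + 10)⁻¹)) := by
  refine LeeYangGhs.concaveOn_of_hasDerivAt2_nonpos' (convex_Ici _)
    (f' := fun σ => -((σ + (-1)) ^ 2)⁻¹ - (-((σ + 2) ^ 2)⁻¹ + -((σ + 4) ^ 2)⁻¹ +
      -((σ + 6) ^ 2)⁻¹ + -((σ + 8) ^ 2)⁻¹ + -((σ + 10) ^ 2)⁻¹))
    (f'' := fun σ => 2 * ((σ + (-1)) ^ 3)⁻¹ - (2 * ((σ + 2) ^ 3)⁻¹ + 2 * ((σ + 4) ^ 3)⁻¹ +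
      2 * ((σ + 6) ^ 3)⁻¹ + 2 * ((σ + 8) ^ 3)⁻¹ + 2 * ((σ + 10) ^ 3)⁻¹))
    (fun σ hσ => ?_) (fun σ hσ => ?_) (fun σ hσ => ?_)
  · have hσ' : (10 : ℝ) ≤ σ := hσ
    exact (LeeYangGhs.hasDerivAt_inv_add (-1) (by linarith)).sub
      (((((LeeYangGhs.hasDerivAt_inv_add 2 (by linarith)).add
        (LeeYangGhs.hasDerivAt_inv_add 4 (by linarith))).add
        (LeeYangGhs.hasDerivAt_inv_add 6 (by linarith))).add
        (LeeYangGhs.hasDerivAt_inv_add 8 (by linarith))).add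
        (LeeYangGhs.hasDerivAt_inv_add 10 (by linarith)))
  · have hσ' : (10 : ℝ) ≤ σ := hσ
    exact (LeeYangGhs.hasDerivAt_neg_inv_sq_add (-1) (by linarith)).sub
      (((((LeeYangGhs.hasDerivAt_neg_inv_sq_add 2 (by linarith)).add
        (LeeYangGhs.hasDerivAt_neg_inv_sq_add 4 (by linarith))).add
        (LeeYangGhs.hasDerivAt_neg_inv_sq_add 6 (by linarith))).add
        (LeeYangGhs.hasDerivAt_neg_inv_sq_add 8 (by linarith))).add
        (LeeYangGhs.hasDerivAt_neg_inv_sq_add 10 (by linarith)))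
  · have hσ' : (10 : ℝ) ≤ σ := hσ
    set t := σ + (-1) with ht
    have ht9 : 9 ≤ t := by rw [ht]; linarith
    have ht0 : 0 < t := by linarith
    have e2 : σ + 2 = t + 3 := by rw [ht]; ring
    have e4 : σ + 4 = t + 5 := by rw [ht]; ring
    have e6 : σ + 6 = t + 7 := by rw [ht]; ring
    have e8 : σ + 8 = t + 9 := by rw [ht]; ring
    have e10 : σ + 10 = t + 11 := by rw [ht]; ring
    rw [e2, e4, e6, e8, e10]
    have c3 := LeeYangGhs.cube_compare ht9 (by norm_num : (0:ℝ) ≤ 3)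
    have c5 := LeeYangGhs.cube_compare ht9 (by norm_num : (0:ℝ) ≤ 5)
    have c7 := LeeYangGhs.cube_compare ht9 (by norm_num : (0:ℝ) ≤ 7)
    have c9 := LeeYangGhs.cube_compare ht9 (by norm_num : (0:ℝ) ≤ 9)
    have c11 := LeeYangGhs.cube_compare ht9 (by norm_num : (0:ℝ) ≤ 11)
    have hsum : (1 : ℝ) ≤ 729 / (9 + 3) ^ 3 + 729 / (9 + 5) ^ 3 + 729 / (9 + 7) ^ 3 +
        729 / (9 + 9) ^ 3 + 729 / (9 + 11) ^ 3 := by norm_num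
    have hpos : 0 < (t ^ 3)⁻¹ := by positivity
    nlinarith

/-- The tail terms of the digamma series are concave on `[10, ∞)`:
`σ ↦ 1/(k+7) − 2(σ + 2(k+6))⁻¹`. [folklore] -/
theorem LeeYangGhs.concaveOn_digammaTerm (k : ℕ) :
    ConcaveOn ℝ (Ici (10 : ℝ))
      (fun σ : ℝ => 1 / ((k : ℝ) + 7) - 2 * (σ + 2 * ((k : ℝ) + 6))⁻¹) := by
  set m : ℝ := 2 * ((k : ℝ) + 6) with hm
  have hm0 : 0 ≤ m := by rw [hm]; positivity
  refine LeeYangGhs.concaveOn_of_hasDerivAt2_nonpos' (convex_Ici _)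
    (f' := fun σ => -(2 * -((σ + m) ^ 2)⁻¹))
    (f'' := fun σ => -(2 * (2 * ((σ + m) ^ 3)⁻¹)))
    (fun σ hσ => ?_) (fun σ hσ => ?_) (fun σ hσ => ?_)
  · have hσ' : (10 : ℝ) ≤ σ := hσ
    exact ((LeeYangGhs.hasDerivAt_inv_add m (by linarith)).const_mul 2).const_sub _
  · have hσ' : (10 : ℝ) ≤ σ := hσ
    exact ((LeeYangGhs.hasDerivAt_neg_inv_sq_add m (by linarith)).const_mul 2).neg
  · have hσ' : (10 : ℝ) ≤ σ := hσ
    have : 0 < ((σ + m) ^ 3)⁻¹ := by positivity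
    nlinarith

/-- The von Mangoldt terms are concave: `σ ↦ −Λ(n) e^{−σ log n}` (and `0` for `n = 0`). [folklore] -/
theorem LeeYangGhs.concaveOn_vonMangoldtTerm (n : ℕ) :
    ConcaveOn ℝ (Ici (10 : ℝ))
      (fun σ : ℝ => if n = 0 then (0 : ℝ) else -(Λ n * Real.exp (-(Real.log n * σ)))) := by
  by_cases hn : n = 0
  · simp only [hn, if_true]
    exact concaveOn_const 0 (convex_Ici _)
  · simp only [hn, if_false]
    set lg : ℝ := Real.log n with hlg
    have hΛ : 0 ≤ (Λ n : ℝ) := ArithmeticFunction.vonMangoldt_nonneg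
    have hd : ∀ σ : ℝ, HasDerivAt (fun σ : ℝ => Real.exp (-(lg * σ)))
        (Real.exp (-(lg * σ)) * (-lg)) σ := fun σ => by
      have h0 : HasDerivAt (fun σ : ℝ => -(lg * σ)) (-(lg * 1)) σ :=
        ((hasDerivAt_id' σ).const_mul lg).neg
      simpa using h0.exp
    refine LeeYangGhs.concaveOn_of_hasDerivAt2_nonpos' (convex_Ici _)
      (f' := fun σ => -((Λ n : ℝ) * (Real.exp (-(lg * σ)) * (-lg))))
      (f'' := fun σ => -((Λ n : ℝ) * ((Real.exp (-(lg * σ)) * (-lg)) * (-lg))))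
      (fun σ _ => ((hd σ).const_mul _).neg) (fun σ _ => ?_) (fun σ _ => ?_)
    · have := ((hd σ).mul_const (-lg)).const_mul (Λ n : ℝ)
      exact this.neg
    · have hex : 0 < Real.exp (-(lg * σ)) := Real.exp_pos _
      have : 0 ≤ (Λ n : ℝ) * (Real.exp (-(lg * σ)) * lg ^ 2) := by positivity
      nlinarith

/-- **The digamma series on the real axis**: for `σ > 0`,
`Σ_k (1/(k+1) − 2/(σ+2k)) = Re ψ(σ/2) + γ`. [folklore] -/
theorem LeeYangGhs.hasSum_re_digamma_half {σ : ℝ} (hσ : 0 < σ) :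
    HasSum (fun k : ℕ => 1 / ((k : ℝ) + 1) - 2 / (σ + 2 * k))
      ((Complex.digamma ((σ : ℂ) / 2)).re + Real.eulerMascheroniConstant) := by
  have hw : 0 < (((σ : ℂ) / 2)).re := by
    rw [Complex.div_ofNat_re, Complex.ofReal_re]; positivity
  have h := Literature.Analysis.SpecialFunctions.Complex.hasSum_one_div_sub_one_div_digamma hw
  have hre := Complex.reCLM.hasSum h
  simp only [Complex.reCLM_apply, Complex.add_re, Complex.ofReal_re] at hre
  refine hre.congr_fun fun k => ?_
  have e1 : ((k : ℂ) + 1) = (((k : ℝ) + 1 : ℝ) : ℂ) := by push_cast; ring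
  have e2 : ((σ : ℂ) / 2 + k) = ((σ / 2 + k : ℝ) : ℂ) := by push_cast; ring
  have hre1 : ∀ x : ℝ, ((1 : ℂ) / (x : ℂ)).re = 1 / x := fun x => by
    rw [← Complex.ofReal_one, ← Complex.ofReal_div, Complex.ofReal_re]
  rw [Complex.sub_re, e1, e2, hre1, hre1]
  have hne : σ / 2 + (k : ℝ) ≠ 0 := by positivity
  have hne' : σ + 2 * (k : ℝ) ≠ 0 := by positivity
  field_simp

/-- **The von Mangoldt series on the real axis**: for `σ > 1`,
`Σ_{n ≥ 1} Λ(n) e^{−σ log n} = Re Σ Λ(n) n^{−σ}`. [folklore] -/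
theorem LeeYangGhs.hasSum_re_LSeries_vonMangoldt {σ : ℝ} (hσ : 1 < σ) :
    HasSum (fun n : ℕ => if n = 0 then (0 : ℝ) else (Λ n : ℝ) * Real.exp (-(Real.log n * σ)))
      (LSeries (fun n => ((Λ n : ℝ) : ℂ)) (σ : ℂ)).re := by
  have hs : 1 < ((σ : ℂ)).re := by simpa using hσ
  have h := (ArithmeticFunction.LSeriesSummable_vonMangoldt hs).hasSum
  have hre := Complex.reCLM.hasSum h
  simp only [Complex.reCLM_apply] at hre
  refine hre.congr_fun fun n => ?_
  by_cases hn : n = 0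
  · simp [hn, LSeries.term_zero]
  · simp only [hn, if_false]
    rw [LSeries.term_of_ne_zero hn]
    have hn0 : 0 < (n : ℝ) := Nat.cast_pos.2 (Nat.pos_of_ne_zero hn)
    rw [show (n : ℂ) = ((n : ℝ) : ℂ) from (Complex.ofReal_natCast n).symm,
      ← Complex.ofReal_cpow hn0.le, ← Complex.ofReal_div, Complex.ofReal_re,
      Real.rpow_def_of_pos hn0, div_eq_mul_inv, ← Real.exp_neg]

/-- **`Re ξ'/ξ` on the real axis, `σ > 1`**:
`Re ξ'/ξ(σ) = 1/σ + 1/(σ−1) − (log π)/2 + ½ Re ψ(σ/2) − Re Σ Λ(n) n^{−σ}`. [folklore] -/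
theorem LeeYangGhs.re_logDeriv_riemannXi_of_one_lt {σ : ℝ} (hσ : 1 < σ) :
    (logDeriv riemannXi (σ : ℂ)).re = 1 / σ + 1 / (σ - 1) - Real.log Real.pi / 2 +
      1 / 2 * (Complex.digamma ((σ : ℂ) / 2)).re -
      (LSeries (fun n => ((Λ n : ℝ) : ℂ)) (σ : ℂ)).re := by
  have hs : 1 < ((σ : ℂ)).re := by simpa using hσ
  have h := logDeriv_riemannXi_eq_of_one_lt_re hs
  rw [h]
  have e1 : ((σ : ℂ) - 1) = ((σ - 1 : ℝ) : ℂ) := by push_cast; ring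
  have e2 : (1 : ℂ) / 2 * Complex.digamma ((σ : ℂ) / 2) =
      ((1 / 2 : ℝ) : ℂ) * Complex.digamma ((σ : ℂ) / 2) := by push_cast; ring
  have e3 : (-(Real.log Real.pi : ℂ) / 2) = ((-(Real.log Real.pi) / 2 : ℝ) : ℂ) := by push_cast; ring
  have hre1 : ∀ x : ℝ, ((1 : ℂ) / (x : ℂ)).re = 1 / x := fun x => by
    rw [← Complex.ofReal_one, ← Complex.ofReal_div, Complex.ofReal_re]
  rw [Complex.sub_re, Complex.add_re, Complex.add_re, Complex.add_re, e1, e2, e3,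
    hre1, hre1, Complex.ofReal_re, Complex.re_ofReal_mul]
  ring

/-- **`Re ξ'/ξ` is concave on `[10, ∞)`** (explicit formula, digamma series). [folklore] -/
theorem LeeYangGhs.concaveOn_re_logDeriv_riemannXi_Ici :
    ConcaveOn ℝ (Ici (10 : ℝ)) (fun σ : ℝ => (logDeriv riemannXi (σ : ℂ)).re) := by
  -- the four pieces
  set A : ℝ → ℝ := fun σ => (σ + (-1))⁻¹ -
      ((σ + 2)⁻¹ + (σ + 4)⁻¹ + (σ + 6)⁻¹ + (σ + 8)⁻¹ + (σ + 10)⁻¹) with hA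
  set Bt : ℕ → ℝ → ℝ := fun k σ => 1 / ((k : ℝ) + 7) - 2 * (σ + 2 * ((k : ℝ) + 6))⁻¹ with hBt
  set B : ℝ → ℝ := fun σ => (Complex.digamma ((σ : ℂ) / 2)).re + Real.eulerMascheroniConstant -
      ∑ k ∈ Finset.range 6, (1 / ((k : ℝ) + 1) - 2 / (σ + 2 * k)) with hB
  set Ct : ℕ → ℝ → ℝ := fun n σ =>
      if n = 0 then (0 : ℝ) else -((Λ n : ℝ) * Real.exp (-(Real.log n * σ))) with hCt
  set C : ℝ → ℝ := fun σ => -(LSeries (fun n => ((Λ n : ℝ) : ℂ)) (σ : ℂ)).re with hC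
  set κ : ℝ := -(Real.log Real.pi) / 2 - Real.eulerMascheroniConstant / 2 +
      1 / 2 * ∑ k ∈ Finset.range 6, 1 / ((k : ℝ) + 1) with hκ
  have hAc : ConcaveOn ℝ (Ici (10 : ℝ)) A := LeeYangGhs.concaveOn_bracket
  have hBc : ConcaveOn ℝ (Ici (10 : ℝ)) B := by
    refine LeeYangGhs.concaveOn_of_hasSum (f := Bt) (convex_Ici _)
      (fun k => LeeYangGhs.concaveOn_digammaTerm k) (fun σ hσ => ?_)
    have hσ' : (10 : ℝ) ≤ σ := hσ
    have h := LeeYangGhs.hasSum_re_digamma_half (σ := σ) (by linarith)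
    have h6 := (hasSum_nat_add_iff' 6).2 h
    refine h6.congr_fun fun k => ?_
    simp only [hBt]
    have hne : σ + 2 * ((k : ℝ) + 6) ≠ 0 := by positivity
    push_cast
    field_simp
    ring
  have hCc : ConcaveOn ℝ (Ici (10 : ℝ)) C := by
    refine LeeYangGhs.concaveOn_of_hasSum (f := Ct) (convex_Ici _)
      (fun n => LeeYangGhs.concaveOn_vonMangoldtTerm n) (fun σ hσ => ?_)
    have hσ' : (10 : ℝ) ≤ σ := hσ
    have h := (LeeYangGhs.hasSum_re_LSeries_vonMangoldt (σ := σ) (by linarith)).neg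
    refine h.congr_fun fun n => ?_
    simp only [hCt]
    split_ifs <;> simp
  have hκc : ConcaveOn ℝ (Ici (10 : ℝ)) (fun _ => κ) := concaveOn_const κ (convex_Ici _)
  have hsum : ConcaveOn ℝ (Ici (10 : ℝ)) (fun σ => A σ + κ + (1 / 2 : ℝ) • B σ + C σ) := by
    have := ((hAc.add hκc).add (hBc.smul (by norm_num : (0 : ℝ) ≤ 1 / 2))).add hCc
    exact this
  refine hsum.congr fun σ hσ => ?_
  have hσ' : (10 : ℝ) ≤ σ := hσ
  rw [LeeYangGhs.re_logDeriv_riemannXi_of_one_lt (by linarith)]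
  simp only [hA, hB, hC, hκ, smul_eq_mul, Finset.sum_range_succ, Finset.sum_range_zero]
  have h0 : σ ≠ 0 := by linarith
  have h1 : σ - 1 ≠ 0 := by linarith
  have h1' : σ + (-1) ≠ 0 := by linarith
  have h2 : σ + 2 ≠ 0 := by linarith
  have h4 : σ + 4 ≠ 0 := by linarith
  have h6 : σ + 6 ≠ 0 := by linarith
  have h8 : σ + 8 ≠ 0 := by linarith
  have h10 : σ + 10 ≠ 0 := by linarith
  push_cast
  field_simp
  ring

end Summit.RiemannHypothesis.RiemannHypothesis.Theorems
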